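import Summits.QuantumFields.YangMills.Theorems.LuscherReductionDressedRitzOfOperatorPlateau
import Summits.QuantumFields.YangMills.Theorems.FemtoTransferGapGroundState
import HarnessLib

/-!
# Route `LuscherReduction`, item `DressedRitz` (stmt-QuantumFields-20205) — the VACUUM DICTIONARY, part 1: the vacuum package `IsVacuum`,
# form gap ⇒ operator gap ⇒ power iteration with Jentzsch's rate

Support module of the `FemtoTransferGap` group (fleet service by seat ym-infvol-p2 g6; route `LuscherReduction`, femto rung R2b1; bears on the
crux child `DressedRitz` = stmt-QuantumFields-20205 of RED stmt-QuantumFields-19978).  CONTENT = §0–§2 of the planner's crux workfile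
`Summits/QuantumFields/YangMills/Cruxes/RunningReduction/Lines/VacuumDictionary.lean` (rev 2, sha16 73f604c4d3f1017c, seat ym-cruxidea-19978-1
GEN 6; kernel-checked there, farm rc 0) RE-HOMED VERBATIM on the Theorems side (namespace `…Theorems.FemtoTransferGap.VacDict`; the two helpers
`isPhys_mul`/`isPhys_sub` are the tree's `OpPlat.isPhys_mul`/`OpPlat.isPhys_sub` of `…DressedRitzOfOperatorPlateau.lean`, not re-declared).

WHY.  The typed cut of item 20205 is `KTGen.ExcitedPlateauAt k` ∕ `OpPlat.OperatorPlateauAt k` (`…DressedRitzPlateauDefs.lean`): its vacuum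
generator is the EXACT physical ground state `Ω` of the zero-flux transfer operator `K_β` and every remaining clause is a number attached to `Ω`.
A prover computes EUCLIDEAN quantities: path integrals over slabs `L³ × T`.  Parts 1–2 prove, over the tree's objects and with no new facts, that
every such vacuum number IS a limit of free-boundary slab expectations, with a geometric rate.

* §0 raw-currency helpers: `l2_mul_self_le`, `qform_self_le_levelValue_zero_mul` (`⟨ψ,K_βψ⟩ ≤ λ₀‖ψ‖²` with no positivity proviso),
  `abs_l2_le_sqrt_mul_sqrt`.
* §1 `IsVacuum β Ω θ` — the tree's ground-state package (`PhysL2.exists_groundState`: `‖Ω‖ = 1`, `K_βΩ = λ₀Ω`, Jentzsch gap `⟨ψ,K_βψ⟩ ≤ θ‖ψ‖²`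
  on `Ω^⊥`, `0 ≤ θ < λ₀`) read in the linear-algebra currency of `KTPhysSpace` (`physSubmodule`, `l2Form`, `transferOp`); `exists_isVacuum`
  (with `Ω ≥ c > 0` pointwise); `IsVacuum.raw`, `l2Form_vac_transferOp`, `transferOp_orth`.
* §2 FORM GAP ⇒ OPERATOR GAP ⇒ POWER ITERATION WITH RATE: `‖K_βψ‖² ≤ θ²‖ψ‖²` on `Ω^⊥` (Cauchy–Schwarz for the positive form `qform`, tree
  `sq_qform_le`); `K_β^m ψ = (⟨Ω,ψ⟩λ₀^m)Ω + K_β^m ξ` with `‖K_β^m ξ‖² ≤ θ^{2m}‖ψ‖²` (`normSq_iterate_sub_le`).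
Part 2 (`…DressedRitzVacuumDictionaryLimits.lean`): the dictionary `tendsto_ratio`, slab corollaries `tendsto_onePoint` ∕ `tendsto_twoPoint` ∕
`tendsto_feynmanKac`, and vacuum subtraction.

HONEST FRAMING: fixed-lattice functional analysis (femto rung R2b1); no renormalisation-group content; the RG estimates of the slab expectations are the
prover's burden (item 20205 is XL for that reason); nothing here bears on infinite volume, the continuum or the Clay gap.
References: M. Reed, B. Simon IV (1978) Thm XIII.43–44 [cite: ReedSimonIV1978, Thm XIII.43]; E. Seiler, LNP 159 (1982) §3 [cite: SeilerLNP1982, §3];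
M. Lüscher, NPB 219 (1983) [cite: Luscher1983, §2].
-/

set_option autoImplicit false

noncomputable section

open MeasureTheory Filter Topology Real
open Literature.MathematicalPhysics.QuantumFieldTheory
open Literature.MathematicalPhysics.QuantumLattice
open Literature.Analysis.OperatorTheory.YMMatrixModel
open scoped BigOperators

namespace Summit.QuantumFields.YangMills.Theorems.FemtoTransferGap.VacDict

open Summit.QuantumFields.YangMills.Theorems.FemtoTransferGap
open Summit.QuantumFields.YangMills.Theorems.FemtoTransferGap.PhysL2
open Summit.QuantumFields.YangMills.Theorems.FemtoTransferGap.OpPlat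

variable {L : ℕ} [NeZero L]

/-! ## §0 Raw-currency helpers (`isPhys_mul` ∕ `isPhys_sub`: see `OpPlat`) -/

/-- `‖fψ‖² ≤ C²‖ψ‖²` for `|f| ≤ C`. [folklore] -/
theorem l2_mul_self_le {f ψ : GaugeConfig 3 L SU2 → ℝ} (hf : IsPhys f) (hψ : IsPhys ψ) {C : ℝ} (hC : ∀ U, |f U| ≤ C) :
    l2 (f * ψ) (f * ψ) ≤ C ^ 2 * l2 ψ ψ := by
  have hfψ := isPhys_mul hf hψ
  unfold l2
  rw [← integral_const_mul]
  refine integral_mono (hfψ.integrable_mul hfψ) ((hψ.integrable_mul hψ).const_mul _) fun U => ?_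
  have h1 : (f * ψ) U * (f * ψ) U = f U ^ 2 * (ψ U * ψ U) := by simp only [Pi.mul_apply]; ring
  rw [h1]
  have hf2 : f U ^ 2 ≤ C ^ 2 := by
    have := hC U
    have h0 : 0 ≤ C := (abs_nonneg _).trans this
    calc f U ^ 2 = |f U| ^ 2 := (sq_abs _).symm
      _ ≤ C ^ 2 := pow_le_pow_left₀ (abs_nonneg _) this 2
  exact mul_le_mul_of_nonneg_right hf2 (mul_self_nonneg _)

/-- `⟨ψ, K_βψ⟩ ≤ λ₀ ‖ψ‖²` for EVERY physical `ψ` (no positivity proviso: if `‖ψ‖² = 0` then `⟨ψ,K_βψ⟩ = ⟨ψ, Kψ⟩_{L²} = 0` by Cauchy–Schwarz).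
[cite: ReedSimonIV1978, Thm. XIII.1] -/
theorem qform_self_le_levelValue_zero_mul (β : ℝ) {ψ : GaugeConfig 3 L SU2 → ℝ} (hψ : IsPhys ψ) :
    qform su2Rep β ψ ψ ≤ levelValue su2Rep L β 0 * l2 ψ ψ := by
  rcases (l2_self_nonneg ψ).eq_or_lt with h0 | hpos
  · have hK := isPhys_transferApply (L := L) β hψ
    have hcs := sq_l2_le hψ hK
    rw [← h0, zero_mul] at hcs
    have hz : l2 ψ (transferApply β ψ) = 0 := pow_eq_zero_iff two_ne_zero |>.mp (le_antisymm hcs (sq_nonneg _))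
    rw [qform_eq_l2_transferApply, hz, ← h0, mul_zero]
  · exact qform_le_levelValue_zero_mul su2Rep continuous_su2Rep β hψ hpos

/-- `|⟨x,y⟩| ≤ √‖x‖² · √‖y‖²` (Cauchy–Schwarz, square-root form). [folklore] -/
theorem abs_l2_le_sqrt_mul_sqrt {f g : GaugeConfig 3 L SU2 → ℝ} (hf : IsPhys f) (hg : IsPhys g) :
    |l2 f g| ≤ Real.sqrt (l2 f f) * Real.sqrt (l2 g g) := by
  rw [← Real.sqrt_mul (l2_self_nonneg f)]
  exact Real.abs_le_sqrt (sq_l2_le hf hg)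

/-! ## §1 The vacuum package in the linear-algebra currency of `KTPhysSpace` -/

/-- **The vacuum package** at fixed lattice `(L, β)`: `Ω` is a physical unit vector, an exact top eigenvector of the transfer operator
(`K_βΩ = λ₀Ω`, `λ₀ = levelValue su2Rep L β 0`), and `θ ∈ [0, λ₀)` is a Jentzsch bound: `⟨ψ, K_βψ⟩ ≤ θ‖ψ‖²` for every physical `ψ ⊥ Ω`.
[cite: ReedSimonIV1978, Thm XIII.43 and Thm XIII.44] -/
structure IsVacuum (β : ℝ) (Ω : physSubmodule L) (θ : ℝ) : Prop where
  norm_one : l2Form L Ω Ω = 1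
  eigen : transferOp β Ω = levelValue su2Rep L β 0 • Ω
  theta_nonneg : 0 ≤ θ
  theta_lt : θ < levelValue su2Rep L β 0
  gap : ∀ ψ : physSubmodule L, l2Form L Ω ψ = 0 → l2Form L ψ (transferOp β ψ) ≤ θ * l2Form L ψ ψ

/-- **Existence of the vacuum package**, with `Ω` uniformly positive (`0 < c ≤ Ω`) — the tree's `PhysL2.exists_groundState` read in the
`physSubmodule` currency; every `L ≥ 1`, every real `β`. [cite: ReedSimonIV1978, Thm XIII.43 and Thm XIII.44] -/
theorem exists_isVacuum (β : ℝ) :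
    ∃ (Ω : physSubmodule L) (θ c : ℝ), IsVacuum β Ω θ ∧ 0 < c ∧ ∀ U, c ≤ (Ω : GaugeConfig 3 L SU2 → ℝ) U := by
  obtain ⟨Ω, θ, c, hΩ, hc, hcle, hn, heig, hθ0, hθ, hgap⟩ := exists_groundState (L := L) β
  refine ⟨⟨Ω, hΩ⟩, θ, c, ⟨?_, ?_, hθ0, ?_, ?_⟩, hc, fun U => hcle U⟩
  · simpa using hn
  · apply Subtype.ext
    simp only [coe_transferOp, Submodule.coe_smul]
    rw [levelValue_zero]
    exact heig
  · rw [levelValue_zero]; exact hθ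
  · intro ψ hψ
    rw [l2Form_transferOp_right, l2Form_apply]
    rw [l2Form_apply, l2_comm] at hψ
    exact hgap ψ ψ.2 hψ

section Vacuum

variable {β θ : ℝ} {Ω : physSubmodule L}

/-- The vacuum in RAW currency — exactly the witness `φ` of clause (x3) of `KTGen.ExcitedPlateau`: `↑Ω` is physical, `‖Ω‖² = 1`,
`K_β Ω = λ₀ Ω` as functions. [folklore] -/
theorem IsVacuum.raw (hV : IsVacuum β Ω θ) :
    IsPhys (Ω : GaugeConfig 3 L SU2 → ℝ) ∧ l2 (Ω : GaugeConfig 3 L SU2 → ℝ) (Ω : GaugeConfig 3 L SU2 → ℝ) = 1 ∧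
      transferApply β (Ω : GaugeConfig 3 L SU2 → ℝ) = levelValue su2Rep L β 0 • (Ω : GaugeConfig 3 L SU2 → ℝ) := by
  refine ⟨isPhys_coe Ω, ?_, ?_⟩
  · rw [← l2Form_apply]; exact hV.norm_one
  · have h := congrArg (fun x : physSubmodule L => (x : GaugeConfig 3 L SU2 → ℝ)) hV.eigen
    simpa only [coe_transferOp, Submodule.coe_smul] using h

/-- `⟨Ω, K_βψ⟩ = λ₀⟨Ω, ψ⟩` (symmetry of `K_β` + the eigen-equation). [folklore] -/
theorem l2Form_vac_transferOp (hV : IsVacuum β Ω θ) (ψ : physSubmodule L) :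
    l2Form L Ω (transferOp β ψ) = levelValue su2Rep L β 0 * l2Form L Ω ψ := by
  rw [← transferOp_symm, hV.eigen, map_smul, LinearMap.smul_apply, smul_eq_mul]

/-- `K_β` preserves `Ω^⊥`. [folklore] -/
theorem transferOp_orth (hV : IsVacuum β Ω θ) {ψ : physSubmodule L} (h : l2Form L Ω ψ = 0) :
    l2Form L Ω (transferOp β ψ) = 0 := by
  rw [l2Form_vac_transferOp hV, h, mul_zero]

/-! ## §2 Form gap ⇒ operator gap ⇒ power iteration with Jentzsch's rate -/

/-- **FORM GAP ⇒ OPERATOR GAP**: `‖K_βψ‖² ≤ θ²‖ψ‖²` for physical `ψ ⊥ Ω` (`β ≥ 0`).  Proof: `N := ‖Kψ‖² = ⟨ψ, K(Kψ)⟩ = qform(ψ, Kψ)`, and the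
Cauchy–Schwarz inequality of the POSITIVE form `qform` (tree `sq_qform_le`) gives `N² ≤ qform(ψ,ψ)·qform(Kψ,Kψ) ≤ θ‖ψ‖² · θN`
(`Kψ ⊥ Ω`). [cite: ReedSimonIV1978, Thm. XIII.1] -/
theorem normSq_transferOp_le_of_orth (hV : IsVacuum β Ω θ) (hβ : 0 ≤ β) {ψ : physSubmodule L} (h : l2Form L Ω ψ = 0) :
    l2Form L (transferOp β ψ) (transferOp β ψ) ≤ θ ^ 2 * l2Form L ψ ψ := by
  set N := l2Form L (transferOp β ψ) (transferOp β ψ) with hN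
  have hNq : N = qform su2Rep β (ψ : GaugeConfig 3 L SU2 → ℝ) ((transferOp β ψ : physSubmodule L) : GaugeConfig 3 L SU2 → ℝ) := by
    rw [hN, transferOp_symm, l2Form_transferOp_right]
  have h1 : qform su2Rep β (ψ : GaugeConfig 3 L SU2 → ℝ) ψ ≤ θ * l2Form L ψ ψ := by
    have := hV.gap ψ h
    rwa [l2Form_transferOp_right] at this
  have h2 : qform su2Rep β ((transferOp β ψ : physSubmodule L) : GaugeConfig 3 L SU2 → ℝ)
      ((transferOp β ψ : physSubmodule L) : GaugeConfig 3 L SU2 → ℝ) ≤ θ * N := by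
    have := hV.gap (transferOp β ψ) (transferOp_orth hV h)
    rwa [l2Form_transferOp_right] at this
  have hcs := sq_qform_le hβ (isPhys_coe ψ) (isPhys_coe (transferOp β ψ))
  rw [← hNq] at hcs
  have hN0 : 0 ≤ N := l2Form_self_nonneg _
  have hψ0 : 0 ≤ l2Form L ψ ψ := l2Form_self_nonneg _
  have hmain : N ^ 2 ≤ (θ * l2Form L ψ ψ) * (θ * N) :=
    hcs.trans (mul_le_mul h1 h2 (qform_su2Rep_self_nonneg hβ (isPhys_coe _)) (mul_nonneg hV.theta_nonneg hψ0))
  rcases hN0.eq_or_lt with hz | hpos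
  · rw [← hz]; exact mul_nonneg (sq_nonneg _) hψ0
  · have : N * N ≤ (θ ^ 2 * l2Form L ψ ψ) * N := by nlinarith [hmain]
    exact le_of_mul_le_mul_right this hpos

/-- `‖K_βψ‖² ≤ λ₀²‖ψ‖²` for EVERY physical `ψ` (same argument with the top Rayleigh bound in place of the gap). [cite: ReedSimonIV1978, Thm. XIII.1] -/
theorem normSq_transferOp_le (hβ : 0 ≤ β) (ψ : physSubmodule L) :
    l2Form L (transferOp β ψ) (transferOp β ψ) ≤ levelValue su2Rep L β 0 ^ 2 * l2Form L ψ ψ := by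
  set N := l2Form L (transferOp β ψ) (transferOp β ψ) with hN
  set lam := levelValue su2Rep L β 0 with hlam
  have hlam0 : 0 ≤ lam := (levelValue_zero_su2Rep_pos L β).le
  have hNq : N = qform su2Rep β (ψ : GaugeConfig 3 L SU2 → ℝ) ((transferOp β ψ : physSubmodule L) : GaugeConfig 3 L SU2 → ℝ) := by
    rw [hN, transferOp_symm, l2Form_transferOp_right]
  have h1 : qform su2Rep β (ψ : GaugeConfig 3 L SU2 → ℝ) ψ ≤ lam * l2Form L ψ ψ := by
    rw [l2Form_apply]; exact qform_self_le_levelValue_zero_mul β (isPhys_coe ψ)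
  have h2 : qform su2Rep β ((transferOp β ψ : physSubmodule L) : GaugeConfig 3 L SU2 → ℝ)
      ((transferOp β ψ : physSubmodule L) : GaugeConfig 3 L SU2 → ℝ) ≤ lam * N := by
    rw [hN, l2Form_apply]; exact qform_self_le_levelValue_zero_mul β (isPhys_coe _)
  have hcs := sq_qform_le hβ (isPhys_coe ψ) (isPhys_coe (transferOp β ψ))
  rw [← hNq] at hcs
  have hN0 : 0 ≤ N := l2Form_self_nonneg _
  have hψ0 : 0 ≤ l2Form L ψ ψ := l2Form_self_nonneg _
  have hmain : N ^ 2 ≤ (lam * l2Form L ψ ψ) * (lam * N) :=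
    hcs.trans (mul_le_mul h1 h2 (qform_su2Rep_self_nonneg hβ (isPhys_coe _)) (mul_nonneg hlam0 hψ0))
  rcases hN0.eq_or_lt with hz | hpos
  · rw [← hz]; exact mul_nonneg (sq_nonneg _) hψ0
  · have : N * N ≤ (lam ^ 2 * l2Form L ψ ψ) * N := by nlinarith [hmain]
    exact le_of_mul_le_mul_right this hpos

/-- Iterates of `K_β` on the physical subspace agree with the raw iterates `(transferApply β)^[m]`. [folklore] -/
theorem coe_iterate_transferOp (β : ℝ) (m : ℕ) (ψ : physSubmodule L) :
    (((⇑(transferOp (L := L) β))^[m] ψ : physSubmodule L) : GaugeConfig 3 L SU2 → ℝ) =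
      (transferApply (L := L) β)^[m] (ψ : GaugeConfig 3 L SU2 → ℝ) := by
  induction m with
  | zero => rfl
  | succ m ih => rw [Function.iterate_succ_apply', Function.iterate_succ_apply', coe_transferOp, ih]

/-- Iterates are additive. [folklore] -/
theorem iterate_add (β : ℝ) (m : ℕ) (x y : physSubmodule L) :
    (⇑(transferOp (L := L) β))^[m] (x + y) = (⇑(transferOp β))^[m] x + (⇑(transferOp β))^[m] y := by
  induction m with
  | zero => rfl
  | succ m ih => rw [Function.iterate_succ_apply', Function.iterate_succ_apply', Function.iterate_succ_apply', ih, map_add]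

/-- Iterates are homogeneous. [folklore] -/
theorem iterate_smul (β : ℝ) (m : ℕ) (c : ℝ) (x : physSubmodule L) :
    (⇑(transferOp (L := L) β))^[m] (c • x) = c • (⇑(transferOp β))^[m] x := by
  induction m with
  | zero => rfl
  | succ m ih => rw [Function.iterate_succ_apply', Function.iterate_succ_apply', ih, map_smul]

/-- Iterates respect subtraction. [folklore] -/
theorem iterate_sub (β : ℝ) (m : ℕ) (x y : physSubmodule L) :
    (⇑(transferOp (L := L) β))^[m] (x - y) = (⇑(transferOp β))^[m] x - (⇑(transferOp β))^[m] y := by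
  induction m with
  | zero => rfl
  | succ m ih => rw [Function.iterate_succ_apply', Function.iterate_succ_apply', Function.iterate_succ_apply', ih, map_sub]

/-- `K_β^m Ω = λ₀^m Ω`. [folklore] -/
theorem iterate_vac (hV : IsVacuum β Ω θ) (m : ℕ) :
    (⇑(transferOp (L := L) β))^[m] Ω = levelValue su2Rep L β 0 ^ m • Ω := by
  induction m with
  | zero => simp
  | succ m ih => rw [Function.iterate_succ_apply', ih, map_smul, hV.eigen, smul_smul, ← pow_succ]

/-- `K_β^m` preserves `Ω^⊥`. [folklore] -/
theorem iterate_orth (hV : IsVacuum β Ω θ) {ψ : physSubmodule L} (h : l2Form L Ω ψ = 0) (m : ℕ) :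
    l2Form L Ω ((⇑(transferOp (L := L) β))^[m] ψ) = 0 := by
  induction m with
  | zero => simpa using h
  | succ m ih => rw [Function.iterate_succ_apply']; exact transferOp_orth hV ih

/-- **Geometric decay on `Ω^⊥`**: `‖K_β^m ψ‖² ≤ θ^{2m}‖ψ‖²` for physical `ψ ⊥ Ω`. [cite: ReedSimonIV1978, Thm XIII.43 and Thm XIII.44] -/
theorem normSq_iterate_le_of_orth (hV : IsVacuum β Ω θ) (hβ : 0 ≤ β) {ψ : physSubmodule L} (h : l2Form L Ω ψ = 0) (m : ℕ) :
    l2Form L ((⇑(transferOp (L := L) β))^[m] ψ) ((⇑(transferOp β))^[m] ψ) ≤ θ ^ (2 * m) * l2Form L ψ ψ := by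
  induction m with
  | zero => simp
  | succ m ih =>
    rw [Function.iterate_succ_apply']
    calc l2Form L (transferOp β ((⇑(transferOp β))^[m] ψ)) (transferOp β ((⇑(transferOp β))^[m] ψ))
        ≤ θ ^ 2 * l2Form L ((⇑(transferOp β))^[m] ψ) ((⇑(transferOp β))^[m] ψ) :=
          normSq_transferOp_le_of_orth hV hβ (iterate_orth hV h m)
      _ ≤ θ ^ 2 * (θ ^ (2 * m) * l2Form L ψ ψ) := mul_le_mul_of_nonneg_left ih (sq_nonneg _)
      _ = θ ^ (2 * (m + 1)) * l2Form L ψ ψ := by ring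

/-- The component of `ψ` orthogonal to the vacuum: `ξ = ψ − ⟨Ω,ψ⟩Ω ⊥ Ω`. [folklore] -/
theorem orth_of_sub_proj (hV : IsVacuum β Ω θ) (ψ : physSubmodule L) :
    l2Form L Ω (ψ - l2Form L Ω ψ • Ω) = 0 := by
  rw [map_sub, map_smul, smul_eq_mul, hV.norm_one, mul_one, sub_self]

/-- `‖ψ − ⟨Ω,ψ⟩Ω‖² = ‖ψ‖² − ⟨Ω,ψ⟩² ≤ ‖ψ‖²`. [folklore] -/
theorem normSq_sub_proj (hV : IsVacuum β Ω θ) (ψ : physSubmodule L) :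
    l2Form L (ψ - l2Form L Ω ψ • Ω) (ψ - l2Form L Ω ψ • Ω) = l2Form L ψ ψ - l2Form L Ω ψ ^ 2 := by
  have hs : l2Form L ψ Ω = l2Form L Ω ψ := l2Form_symm _ _
  simp only [map_sub, map_smul, LinearMap.sub_apply, LinearMap.smul_apply, smul_eq_mul, hV.norm_one, hs]
  ring

/-- **POWER ITERATION WITH RATE** (the vacuum proxy converges to the vacuum): for every physical `ψ` and every `m`,
`K_β^m ψ = (⟨Ω,ψ⟩ λ₀^m) Ω + R_m` with `‖R_m‖² ≤ θ^{2m} ‖ψ‖²` (`R_m = K_β^m(ψ − ⟨Ω,ψ⟩Ω)`, geometric decay on `Ω^⊥`).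
[cite: ReedSimonIV1978, Thm XIII.43 and Thm XIII.44] -/
theorem iterate_decomp (hV : IsVacuum β Ω θ) (ψ : physSubmodule L) (m : ℕ) :
    (⇑(transferOp (L := L) β))^[m] ψ =
      (l2Form L Ω ψ * levelValue su2Rep L β 0 ^ m) • Ω + (⇑(transferOp β))^[m] (ψ - l2Form L Ω ψ • Ω) := by
  have hsplit : ψ = l2Form L Ω ψ • Ω + (ψ - l2Form L Ω ψ • Ω) := by abel
  conv_lhs => rw [hsplit]
  rw [iterate_add, iterate_smul, iterate_vac hV, smul_smul]

/-- The remainder estimate of `iterate_decomp`. [cite: ReedSimonIV1978, Thm XIII.43 and Thm XIII.44] -/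
theorem normSq_iterate_sub_le (hV : IsVacuum β Ω θ) (hβ : 0 ≤ β) (ψ : physSubmodule L) (m : ℕ) :
    l2Form L ((⇑(transferOp (L := L) β))^[m] ψ - (l2Form L Ω ψ * levelValue su2Rep L β 0 ^ m) • Ω)
        ((⇑(transferOp β))^[m] ψ - (l2Form L Ω ψ * levelValue su2Rep L β 0 ^ m) • Ω) ≤
      θ ^ (2 * m) * l2Form L ψ ψ := by
  have heq : (⇑(transferOp (L := L) β))^[m] ψ - (l2Form L Ω ψ * levelValue su2Rep L β 0 ^ m) • Ω =
      (⇑(transferOp β))^[m] (ψ - l2Form L Ω ψ • Ω) := by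
    rw [iterate_decomp hV ψ m, add_sub_cancel_left]
  rw [heq]
  refine (normSq_iterate_le_of_orth hV hβ (orth_of_sub_proj hV ψ) m).trans ?_
  rw [normSq_sub_proj hV]
  have hθ : 0 ≤ θ ^ (2 * m) := pow_nonneg hV.theta_nonneg _
  nlinarith [sq_nonneg (l2Form L Ω ψ)]


end Vacuum

end Summit.QuantumFields.YangMills.Theorems.FemtoTransferGap.VacDict

end
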